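import Literature.MathematicalPhysics.QuantumFieldTheory.Balaban1983to89.B9Thm31GpAgmonGradDivDecayClassZd

/-!
# `Balaban1983to89.B9Thm31GpAgmonPackageZd` — [Balaban1985BackgroundPropagators] Thm 3.1 (3.42) p. 397 IN THE PRINTED QUANTIFIER ORDER («there exist positive constants
# δ₀, B₀ dependent on d and L only such that … for an arbitrary configuration U …»): ★★★ `∃ B₀ δ₀ > 0, ∀ cube member, ∀ x y w: entries n = 0, 1, 2` for `G′(1)` with
# PRINT'S weights (`B₀ = 10`, `δ₀ = (12d+30)⁻¹`), and ★★★ `∃ B₀ δ₀ s₀ > 0, ∀ (α₀, θ′) s₀-small, ∀ cube member, ∀ U₀ of the class: entries n = 0, 1, 2` for `G′(U₀)`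
# (`B₀ = 24`, `δ₀ = (48d+120)⁻¹`, `s₀ = (4((2C_uC_l)² + 1))⁻¹`) — the MEMBER-UNIFORM `∃ … ∀ i : ZdIdx` shape the N05 socket `B9SupplySockB9P3Zd.sockB9P3_allLevels_of_thm33` consumes

statement-level skeleton of published theorems with citation tags; proofs where landed; nothing here is a claim about the
Yang–Mills mass gap

`[Balaban1985BackgroundPropagators]` ("B9", CMP **99** (1985) 389–434) Thm 3.1 pp. 397–398 (*«There exist positive constants M₁, δ₀, a₀, B₀ dependent on d and L only … such that
for … an arbitrary configuration U satisfying the regularity condition (3.35) … the operator G′(U) satisfies the inequalities (3.42)–(3.47)»*; quantifier order of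
`B9.Thm31Printed`: the constants BEFORE the member and the background), (3.42) p. 397 (`B9.pref4 = [(Lʲη)², Lʲη, Lʲη, 1]`), (3.24) p. 394 (the weights `a(Lʲη)^{d−2}` — here
`a = 1`, i.e. `a_j = (Lᵈ)ʲ(ηLʲ)⁻²` after the volume factor); `[Balaban1985Averaging]` Prop. 2 p. 26; `[Agmon1982]` Thm 1.5 p. 19.
THIS FILE only PACKAGES this seat's FILES 8, 12, 13, 14, 15 at print's weights: every constant is a numeral or an explicit function of `d` (and of the fibre comparison
`C_u, C_l` for the class threshold) — chosen BEFORE the cube member `i`, its cube data, the level `m`, the sites and the background.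

CITATION HEADER (lean-in-tree rule).  Cell `pub-ymgap` (YM Track A, HUMAN RULING D-0062 ∕ D-0149 width push), DAG node N06 = [B9], width seat
`pub-ymgap-dag-n06-w2` (g5), CLAIM-16.  Inputs BY NAME: `fnorm_GpZd_one_single_le_exp_cubeMember_printWeights` (FILE 8), `fnorm_covDerivFwd_GpZd_one_single_le_exp_cubeMember`
(FILE 13), `fnorm_GpZd_one_restrict_covDivB_bond_le_exp_cubeMember` (FILE 14), `fnorm_GpZd_single_le_exp_nearFlat_cubeMember_of_class` (FILE 12),
`fnorm_covDerivFwd_GpZd_single_le_exp_cubeMember_of_class ∕ fnorm_GpZd_restrict_covDivB_bond_le_exp_cubeMember_of_class` (FILE 15).  Nothing restated.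

WHAT IS PROVED (kernel, 0 sorry, 0 def; no `instance`, no `notation`).
* ★★★ `exists_thm31_entries_GpZd_one_cubeMember` — flat background, print weights: `∃ B₀ δ₀ > 0 ∀ …` entries `n = 0, 1, 2`.
* ★★★ `exists_thm31_entries_GpZd_cubeMember_of_class` — the class: `∃ B₀ δ₀ s₀ > 0 ∀ (α₀, θ′) … ∀ member ∀ U₀ …` entries `n = 0, 1, 2`.

HONEST SCOPE.  (i) Single coarsest-scale rate `δ₀L^{−m}` in `|·|_∞` and amplitude `(ηLᵐ)^{2,1,1}` — NOT print's multi-scale `d(y,y′)` ∕ `Lʲη` on inner shells; (ii) entry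
`n = 3` (covariant Laplacian), (3.43)–(3.47), Thm 3.2∕3.3 are NOT packaged here; (iii) the class is displayed by `pdev U₀ < α₀L^{−2k}` and the BOND smallness
`‖U₀(b) − 1‖ ≤ θ′η` — print's (3.35) via an axial gauge is NOT here; (iv) cube members of [Balaban1985RegularSpaces] (1.131) only (not general admissible `{Ω_j}`).
Count-neutral; N05 ∕ N06 NOT discharged; K1⁹ `stmt-QuantumFields-27364` NOT closed; one finite `𝕋⁴` programme at fixed `ε`, Bałaban as printed; R4 closes only the
conditional finite-`𝕋⁴` rung `BalabanLadder.UV` — nothing continuum ∕ ℝ⁴ ∕ OS ∕ mass gap ∕ Clay.  Unit `pub-ymgap-dag-n06-w2` (g5), 2026-08-28.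
-/

noncomputable section

open scoped BigOperators

namespace Literature.MathematicalPhysics.QuantumFieldTheory.Balaban1983to89.B9Thm31GpAgmonPackageZd

open B7Prop1Explicit (e)
open B7Prop2Explicit (unitaryUnits pdev C0 c2')
open B8Ineq132 (covDerivFwd)
open B8Eq138LandauZd (covDivB)
open B8Eq131CubesAdmissible (cubeFam)
open B8LeafModelZd (ZdIdx)
open B8Eq191FlatLettersCubeMember (cubeLamS_finite)
open B9Thm311PosDefOpenZd (cubeMember_Ω0_finite)
open B9Eq321LandauProjectionZd (suppSub)
open B9Eq324DeltaPrimeAZd (single restrictSite GpZd)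
open B9Eq342CombesThomasFormZd
open B9Thm31GpAgmonDecayFlatCubeZd (fnorm_GpZd_one_single_le_exp_cubeMember_printWeights)
open B9Thm31GpAgmonGradDecayZd (fnorm_covDerivFwd_GpZd_one_single_le_exp_cubeMember)
open B9Thm31GpAgmonDivDecayZd (fnorm_GpZd_one_restrict_covDivB_bond_le_exp_cubeMember)
open B9Thm31GpAgmonDecayNearFlatClassZd (fnorm_GpZd_single_le_exp_nearFlat_cubeMember_of_class)
open B9Thm31GpAgmonGradDivDecayClassZd (fnorm_covDerivFwd_GpZd_single_le_exp_cubeMember_of_class fnorm_GpZd_restrict_covDivB_bond_le_exp_cubeMember_of_class)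
open LatticeNorms (linfDist)

export B7Prop1Explicit (Site)

variable {d : ℕ} {𝔸 : Type*} [CStarAlgebra 𝔸]

variable (L : ℕ) (τ : 𝔸 →ₗ[ℂ] ℂ) [FiniteDimensional ℝ 𝔸] (hτp : ∀ a : 𝔸, a ≠ 0 → 0 < (τ (star a * a)).re)

/-! ## §1  The flat background, print's weights -/

/-- ★★★ **[B9] THM 3.1 (3.42), ENTRIES n = 0, 1, 2, FOR `G′(1)` WITH PRINT'S WEIGHTS — CONSTANTS BEFORE THE MEMBER.**  `2 ≤ L`, `0 < d`, `τ` tracial Hermitian faithful on a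
finite-dimensional nontrivial fibre.  There exist `B₀, δ₀ > 0` (in fact `B₀ = 10`, `δ₀ = (12d+30)⁻¹`) such that for EVERY cube member `i` of (1.131) (`i.Ω = cubeFam false L ac Mc ρc i.k`,
`L ≤ ρc`), every level `m ≤ i.k`, with `a_j = (Lᵈ)ʲ(ηLʲ)⁻²`:  (n = 0) `|(G′(1)δ_y w)(x)|_τ ≤ B₀(ηLᵐ)²e^{−δ₀L^{−m}|x−y|_∞}|w|_τ` (`x, y ∈ □₀`);  (n = 1)
`|(D^η_μG′(1)δ_y w)(x)|_τ ≤ B₀(ηLᵐ)e^{−δ₀L^{−m}|x−y|_∞}|w|_τ` (`x + e_μ, y ∈ □₀`);  (n = 2) `|(G′(1)𝟙_{□₀}D^{η*}δ_{(z,z+e_ν)}X)(x)|_τ ≤ B₀(ηLᵐ)e^{−δ₀L^{−m}|z−x|_∞}|X|_τ` (`z + e_ν, x ∈ □₀`).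
[cite: Balaban1985BackgroundPropagators, Thm 3.1 pp.397–398, (3.42) p.397, (3.24) p.394; Balaban1985RegularSpaces, (1.131) p.99; Agmon1982, Thm 1.5 p.19] -/
theorem exists_thm31_entries_GpZd_one_cubeMember [Nontrivial 𝔸] (hd : 0 < d) (hL : 2 ≤ L) (hτt : ∀ a b : 𝔸, τ (a * b) = τ (b * a))
    (hτs : ∀ a : 𝔸, τ (star a) = starRingEnd ℂ (τ a)) :
    ∃ B₀ δ₀ : ℝ, 0 < B₀ ∧ 0 < δ₀ ∧
      ∀ (i : ZdIdx d L) (ac : Site d) (Mc ρc : ℕ) (hΩ : i.Ω = cubeFam false L ac Mc ρc i.k) (_hρc : L ≤ ρc) (m : ℕ) (_hm : m ≤ i.k),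
        (∀ (x y : Site d), x ∈ (cubeMember_Ω0_finite i hΩ).toFinset → y ∈ (cubeMember_Ω0_finite i hΩ).toFinset → ∀ w : 𝔸,
          fnorm τ ((GpZd L (1 : Site d → Fin d → 𝔸ˣ) i.η τ hτp m (fun j => ((L : ℝ) ^ d) ^ j * ((i.η * (L : ℝ) ^ j) ^ 2)⁻¹)
              (fun j => (cubeLamS_finite L ac Mc ρc i.k m j).toFinset)
              (cubeMember_Ω0_finite i hΩ).toFinset hd i.hη.ne' hτt hτs (fun _ _ => (unitaryUnits 𝔸).one_mem)
              (fun j => by have := i.hη; positivity)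
              (restrictSite (cubeMember_Ω0_finite i hΩ).toFinset (single y w)) : Site d → 𝔸) x) ≤
            B₀ * (i.η * (L : ℝ) ^ m) ^ 2 * Real.exp (-(δ₀ * (((L : ℝ) ^ m)⁻¹ * ((linfDist x y : ℕ) : ℝ)))) * fnorm τ w) ∧
        (∀ (μ : Fin d) (x y : Site d), x + e μ ∈ (cubeMember_Ω0_finite i hΩ).toFinset → y ∈ (cubeMember_Ω0_finite i hΩ).toFinset → ∀ w : 𝔸,
          fnorm τ (covDerivFwd i.η (1 : Site d → Fin d → 𝔸ˣ) μ
              (GpZd L (1 : Site d → Fin d → 𝔸ˣ) i.η τ hτp m (fun j => ((L : ℝ) ^ d) ^ j * ((i.η * (L : ℝ) ^ j) ^ 2)⁻¹)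
                (fun j => (cubeLamS_finite L ac Mc ρc i.k m j).toFinset)
                (cubeMember_Ω0_finite i hΩ).toFinset hd i.hη.ne' hτt hτs (fun _ _ => (unitaryUnits 𝔸).one_mem)
                (fun j => by have := i.hη; positivity)
                (restrictSite (cubeMember_Ω0_finite i hΩ).toFinset (single y w)) : Site d → 𝔸) x) ≤
            B₀ * (i.η * (L : ℝ) ^ m) * Real.exp (-(δ₀ * (((L : ℝ) ^ m)⁻¹ * ((linfDist x y : ℕ) : ℝ)))) * fnorm τ w) ∧
        (∀ (z : Site d) (ν : Fin d) (X : 𝔸) (x : Site d), z + e ν ∈ (cubeMember_Ω0_finite i hΩ).toFinset → x ∈ (cubeMember_Ω0_finite i hΩ).toFinset →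
          fnorm τ ((GpZd L (1 : Site d → Fin d → 𝔸ˣ) i.η τ hτp m (fun j => ((L : ℝ) ^ d) ^ j * ((i.η * (L : ℝ) ^ j) ^ 2)⁻¹)
              (fun j => (cubeLamS_finite L ac Mc ρc i.k m j).toFinset)
              (cubeMember_Ω0_finite i hΩ).toFinset hd i.hη.ne' hτt hτs (fun _ _ => (unitaryUnits 𝔸).one_mem)
              (fun j => by have := i.hη; positivity)
              (restrictSite (cubeMember_Ω0_finite i hΩ).toFinset
                (covDivB i.η (1 : Site d → Fin d → 𝔸ˣ) (fun y μ => if y = z ∧ μ = ν then X else 0))) : Site d → 𝔸) x) ≤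
            B₀ * (i.η * (L : ℝ) ^ m) * Real.exp (-(δ₀ * (((L : ℝ) ^ m)⁻¹ * ((linfDist z x : ℕ) : ℝ)))) * fnorm τ X) := by
  have hd0 : (0 : ℝ) < 12 * (d : ℝ) + 30 := by positivity
  refine ⟨10, (12 * (d : ℝ) + 30)⁻¹, by norm_num, by positivity, fun i ac Mc ρc hΩ hρc m hm => ⟨?_, ?_, ?_⟩⟩
  · -- n = 0 (FILE 8): constant `2 ≤ 10`
    intro x y hx hy w
    have h := fnorm_GpZd_one_single_le_exp_cubeMember_printWeights L τ hτp hd hL hτt hτs i hΩ hρc hm hx hy w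
    refine h.trans ?_
    have hE := Real.exp_pos (-((12 * (d : ℝ) + 30)⁻¹ * (((L : ℝ) ^ m)⁻¹ * ((linfDist x y : ℕ) : ℝ))))
    have hw := fnorm_nonneg τ w
    have hsq := sq_nonneg (i.η * (L : ℝ) ^ m)
    nlinarith [mul_nonneg (mul_nonneg hsq hE.le) hw]
  · -- n = 1 (FILE 13) with `a_lo = a_hi = 1`, `κ = (12d+30)⁻¹`
    intro μ x y hx hy w
    have hmin : min (8 : ℝ) 1 = 1 := min_eq_right (by norm_num)
    have h := fnorm_covDerivFwd_GpZd_one_single_le_exp_cubeMember L τ hτp hd hL hτt hτs i hΩ hρc hm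
      (a := fun j => ((L : ℝ) ^ d) ^ j * ((i.η * (L : ℝ) ^ j) ^ 2)⁻¹) (fun j => by have := i.hη; positivity) (a_lo := 1) (a_hi := 1) one_pos
      (fun j _ => by rw [one_mul]) (fun j _ => by rw [one_mul]) (κ := (12 * (d : ℝ) + 30)⁻¹) (by positivity)
      (by rw [inv_le_one_iff₀]; right; linarith) (by rw [mul_one, inv_mul_cancel₀ hd0.ne', hmin]) μ hx hy w
    rw [hmin, Real.sqrt_one, div_one] at h
    exact h
  · -- n = 2 (FILE 14)
    intro z ν X x hz hx
    have hmin : min (8 : ℝ) 1 = 1 := min_eq_right (by norm_num)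
    have h := fnorm_GpZd_one_restrict_covDivB_bond_le_exp_cubeMember L τ hτp hd hL hτt hτs i hΩ hρc hm
      (a := fun j => ((L : ℝ) ^ d) ^ j * ((i.η * (L : ℝ) ^ j) ^ 2)⁻¹) (fun j => by have := i.hη; positivity) (a_lo := 1) (a_hi := 1) one_pos
      (fun j _ => by rw [one_mul]) (fun j _ => by rw [one_mul]) (κ := (12 * (d : ℝ) + 30)⁻¹) (by positivity)
      (by rw [inv_le_one_iff₀]; right; linarith) (by rw [mul_one, inv_mul_cancel₀ hd0.ne', hmin]) z ν X hz hx
    rw [hmin, Real.sqrt_one, div_one] at h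
    exact h

/-! ## §2  The small-plaquette class, print's weights -/

/-- ★★★ **[B9] THM 3.1 (3.42), ENTRIES n = 0, 1, 2, FOR `G′(U₀)` ON THE SMALL-PLAQUETTE CLASS WITH PRINT'S WEIGHTS — CONSTANTS BEFORE THE MEMBER AND THE BACKGROUND.**
`2 ≤ L`, `0 < d`, `τ` tracial Hermitian faithful on a finite-dimensional nontrivial fibre with `|a|_τ ≤ C_u‖a‖`, `‖a‖ ≤ C_l|a|_τ`.  There exist `B₀, δ₀, s₀ > 0` (in fact `B₀ = 24`,
`δ₀ = (48d+120)⁻¹`, `s₀ = (4((2C_uC_l)² + 1))⁻¹`) such that for all `α₀ > 0`, `θ′ ≥ 0` with `C0 d α₀ ≤ 1∕3`, `2α₀ ≤ c2′ d L`, `dθ′² + d²L²(256(d+1)(d+4)α₀ + θ′)² ≤ s₀`, for EVERY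
cube member `i` (`L ≤ ρc`, `m ≤ i.k`, `ηLᵐ ≤ 1`, `L^{−k} ≤ η`) and EVERY unitary `U₀` with `pdev U₀ < α₀(L^{−k})²`, `‖U₀(x,μ) − 1‖ ≤ θ′η`, with `a_j = (Lᵈ)ʲ(ηLʲ)⁻²`, the three
entries hold: `|(G′(U₀)δ_y w)(x)|_τ ≤ B₀(ηLᵐ)²e^{−δ₀L^{−m}|x−y|_∞}|w|_τ`, `|(D^η_{U₀,μ}G′(U₀)δ_y w)(x)|_τ ≤ B₀(ηLᵐ)e^{…}|w|_τ`, `|(G′(U₀)𝟙_{□₀}D^{η*}_{U₀}δ_{(z,z+e_ν)}X)(x)|_τ ≤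
B₀(ηLᵐ)e^{−δ₀L^{−m}|z−x|_∞}|X|_τ`.
[cite: Balaban1985BackgroundPropagators, Thm 3.1 pp.397–398, (3.42) p.397, Thm 3.11 p.416, (3.24) p.394; Balaban1985Averaging, Prop. 2 p.26, (122)–(126) p.36; Balaban1985RegularSpaces, (1.131) p.99; Agmon1982, Thm 1.5 p.19] -/
theorem exists_thm31_entries_GpZd_cubeMember_of_class [Nontrivial 𝔸] (hd : 0 < d) (hL : 2 ≤ L) (hτt : ∀ a b : 𝔸, τ (a * b) = τ (b * a))
    (hτs : ∀ a : 𝔸, τ (star a) = starRingEnd ℂ (τ a)) {Cu Cl : ℝ} (hCu : ∀ a : 𝔸, fnorm τ a ≤ Cu * ‖a‖) (hCl : ∀ a : 𝔸, ‖a‖ ≤ Cl * fnorm τ a)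
    (hCu0 : 0 ≤ Cu) (hCl0 : 0 ≤ Cl) :
    ∃ B₀ δ₀ s₀ : ℝ, 0 < B₀ ∧ 0 < δ₀ ∧ 0 < s₀ ∧
      ∀ (α₀ θ' : ℝ), 0 < α₀ → C0 d * α₀ ≤ 1 / 3 → 2 * α₀ ≤ c2' d L → 0 ≤ θ' →
        d * θ' ^ 2 + d ^ 2 * (L : ℝ) ^ 2 * (256 * (d + 1) * (d + 4) * α₀ + θ') ^ 2 ≤ s₀ →
      ∀ (i : ZdIdx d L) (ac : Site d) (Mc ρc : ℕ) (hΩ : i.Ω = cubeFam false L ac Mc ρc i.k) (_hρc : L ≤ ρc) (m : ℕ) (_hm : m ≤ i.k)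
        (_hηm : i.η * (L : ℝ) ^ m ≤ 1) (_hkη : ((L : ℝ) ^ i.k)⁻¹ ≤ i.η)
        (U₀ : Site d → Fin d → 𝔸ˣ) (hU : ∀ (x : Site d) (κ' : Fin d), U₀ x κ' ∈ unitaryUnits 𝔸)
        (_h52 : pdev U₀ < α₀ * (((L : ℝ) ^ i.k)⁻¹) ^ 2) (_hR : ∀ (x : Site d) (μ : Fin d), ‖((U₀ x μ : 𝔸ˣ) : 𝔸) - 1‖ ≤ θ' * i.η),
        (∀ (x y : Site d), x ∈ (cubeMember_Ω0_finite i hΩ).toFinset → y ∈ (cubeMember_Ω0_finite i hΩ).toFinset → ∀ w : 𝔸,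
          fnorm τ ((GpZd L U₀ i.η τ hτp m (fun j => ((L : ℝ) ^ d) ^ j * ((i.η * (L : ℝ) ^ j) ^ 2)⁻¹)
              (fun j => (cubeLamS_finite L ac Mc ρc i.k m j).toFinset)
              (cubeMember_Ω0_finite i hΩ).toFinset hd i.hη.ne' hτt hτs hU (fun j => by have := i.hη; positivity)
              (restrictSite (cubeMember_Ω0_finite i hΩ).toFinset (single y w)) : Site d → 𝔸) x) ≤
            B₀ * (i.η * (L : ℝ) ^ m) ^ 2 * Real.exp (-(δ₀ * (((L : ℝ) ^ m)⁻¹ * ((linfDist x y : ℕ) : ℝ)))) * fnorm τ w) ∧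
        (∀ (μ : Fin d) (x y : Site d), x + e μ ∈ (cubeMember_Ω0_finite i hΩ).toFinset → y ∈ (cubeMember_Ω0_finite i hΩ).toFinset → ∀ w : 𝔸,
          fnorm τ (covDerivFwd i.η U₀ μ
              (GpZd L U₀ i.η τ hτp m (fun j => ((L : ℝ) ^ d) ^ j * ((i.η * (L : ℝ) ^ j) ^ 2)⁻¹)
                (fun j => (cubeLamS_finite L ac Mc ρc i.k m j).toFinset)
                (cubeMember_Ω0_finite i hΩ).toFinset hd i.hη.ne' hτt hτs hU (fun j => by have := i.hη; positivity)
                (restrictSite (cubeMember_Ω0_finite i hΩ).toFinset (single y w)) : Site d → 𝔸) x) ≤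
            B₀ * (i.η * (L : ℝ) ^ m) * Real.exp (-(δ₀ * (((L : ℝ) ^ m)⁻¹ * ((linfDist x y : ℕ) : ℝ)))) * fnorm τ w) ∧
        (∀ (z : Site d) (ν : Fin d) (X : 𝔸) (x : Site d), z + e ν ∈ (cubeMember_Ω0_finite i hΩ).toFinset → x ∈ (cubeMember_Ω0_finite i hΩ).toFinset →
          fnorm τ ((GpZd L U₀ i.η τ hτp m (fun j => ((L : ℝ) ^ d) ^ j * ((i.η * (L : ℝ) ^ j) ^ 2)⁻¹)
              (fun j => (cubeLamS_finite L ac Mc ρc i.k m j).toFinset)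
              (cubeMember_Ω0_finite i hΩ).toFinset hd i.hη.ne' hτt hτs hU (fun j => by have := i.hη; positivity)
              (restrictSite (cubeMember_Ω0_finite i hΩ).toFinset
                (covDivB i.η U₀ (fun y μ => if y = z ∧ μ = ν then X else 0))) : Site d → 𝔸) x) ≤
            B₀ * (i.η * (L : ℝ) ^ m) * Real.exp (-(δ₀ * (((L : ℝ) ^ m)⁻¹ * ((linfDist z x : ℕ) : ℝ)))) * fnorm τ X) := by
  have hd0 : (0 : ℝ) < 48 * (d : ℝ) + 120 := by positivity
  set C2 : ℝ := (2 * Cu * Cl) ^ 2 with hC2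
  have hC20 : 0 ≤ C2 := sq_nonneg _
  have hs0 : 0 < (4 * (C2 + 1))⁻¹ := by positivity
  refine ⟨24, (48 * (d : ℝ) + 120)⁻¹, (4 * (C2 + 1))⁻¹, by norm_num, by positivity, hs0, ?_⟩
  intro α₀ θ' hα hα3 hα2 hθ' hE i ac Mc ρc hΩ hρc m hm hηm hkη U₀ hU h52 hR
  have hmin : min (8 : ℝ) 1 = 1 := min_eq_right (by norm_num)
  -- the class smallness at `a_hi = 1`: `4·C2·E ≤ 4·C2·s₀ = C2∕(C2+1) ≤ 1`
  have hsmall : 4 * ((2 * Cu * Cl) ^ 2 * (d * θ' ^ 2 + 1 * d ^ 2 * (L : ℝ) ^ 2 * (256 * (d + 1) * (d + 4) * α₀ + θ') ^ 2)) ≤ min 8 1 := by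
    rw [hmin, one_mul, ← hC2]
    have hE0 : 0 ≤ d * θ' ^ 2 + d ^ 2 * (L : ℝ) ^ 2 * (256 * (d + 1) * (d + 4) * α₀ + θ') ^ 2 := by positivity
    have h1 : 4 * (C2 * (d * θ' ^ 2 + d ^ 2 * (L : ℝ) ^ 2 * (256 * (d + 1) * (d + 4) * α₀ + θ') ^ 2)) ≤ 4 * (C2 * (4 * (C2 + 1))⁻¹) := by
      have := mul_le_mul_of_nonneg_left hE hC20
      linarith
    have h2 : 4 * (C2 * (4 * (C2 + 1))⁻¹) ≤ 1 := by
      rw [show 4 * (C2 * (4 * (C2 + 1))⁻¹) = C2 / (C2 + 1) by field_simp, div_le_one (by positivity)]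
      linarith
    exact h1.trans h2
  have hκ0 : (0 : ℝ) ≤ (48 * (d : ℝ) + 120)⁻¹ := by positivity
  have hκ1 : (48 * (d : ℝ) + 120)⁻¹ ≤ 1 := by rw [inv_le_one_iff₀]; right; linarith
  have hκ : (48 * (d : ℝ) + 120)⁻¹ * (48 * d + 120 * 1) ≤ min 8 1 := by rw [mul_one, inv_mul_cancel₀ hd0.ne', hmin]
  refine ⟨?_, ?_, ?_⟩
  · -- n = 0 (FILE 12): constant `8 ≤ 24`
    intro x y hx hy w
    have h := fnorm_GpZd_single_le_exp_nearFlat_cubeMember_of_class L τ hτp hd hL hτt hτs hCu hCl hCu0 hCl0 i hΩ hρc hm hηm hkη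
      (a := fun j => ((L : ℝ) ^ d) ^ j * ((i.η * (L : ℝ) ^ j) ^ 2)⁻¹) (fun j => by have := i.hη; positivity) (a_lo := 1) (a_hi := 1) one_pos
      (fun j _ => by rw [one_mul]) (fun j _ => by rw [one_mul]) hU hα hα3 hα2 h52 hθ' hR hsmall hκ0 hκ1 hκ hx hy w
    rw [hmin, div_one] at h
    refine h.trans ?_
    have hEx := Real.exp_pos (-((48 * (d : ℝ) + 120)⁻¹ * (((L : ℝ) ^ m)⁻¹ * ((linfDist x y : ℕ) : ℝ))))
    have hw := fnorm_nonneg τ w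
    have hsq := sq_nonneg (i.η * (L : ℝ) ^ m)
    nlinarith [mul_nonneg (mul_nonneg hsq hEx.le) hw]
  · -- n = 1 (FILE 15)
    intro μ x y hx hy w
    have h := fnorm_covDerivFwd_GpZd_single_le_exp_cubeMember_of_class L τ hτp hd hL hτt hτs hCu hCl hCu0 hCl0 i hΩ hρc hm hηm hkη
      (a := fun j => ((L : ℝ) ^ d) ^ j * ((i.η * (L : ℝ) ^ j) ^ 2)⁻¹) (fun j => by have := i.hη; positivity) (a_lo := 1) (a_hi := 1) one_pos
      (fun j _ => by rw [one_mul]) (fun j _ => by rw [one_mul]) hU hα hα3 hα2 h52 hθ' hR hsmall hκ0 hκ1 hκ μ hx hy w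
    rw [hmin, Real.sqrt_one, div_one] at h
    exact h
  · -- n = 2 (FILE 15)
    intro z ν X x hz hx
    have h := fnorm_GpZd_restrict_covDivB_bond_le_exp_cubeMember_of_class L τ hτp hd hL hτt hτs hCu hCl hCu0 hCl0 i hΩ hρc hm hηm hkη
      (a := fun j => ((L : ℝ) ^ d) ^ j * ((i.η * (L : ℝ) ^ j) ^ 2)⁻¹) (fun j => by have := i.hη; positivity) (a_lo := 1) (a_hi := 1) one_pos
      (fun j _ => by rw [one_mul]) (fun j _ => by rw [one_mul]) hU hα hα3 hα2 h52 hθ' hR hsmall hκ0 hκ1 hκ z ν X hz hx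
    rw [hmin, Real.sqrt_one, div_one] at h
    exact h

end Literature.MathematicalPhysics.QuantumFieldTheory.Balaban1983to89.B9Thm31GpAgmonPackageZd

end
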